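import Literature.MathematicalPhysics.QuantumFieldTheory.Balaban1983to89.Node00.BgConstraintOfRecord
import Literature.MathematicalPhysics.QuantumFieldTheory.Balaban1983to89.Node00.BgCurrentOfRecord
import Literature.MathematicalPhysics.QuantumFieldTheory.Balaban1983to89.B9Eq3119DeltaPiCarrier
import Literature.MathematicalPhysics.QuantumFieldTheory.Balaban1983to89.B9Eq3119InvariantExtension
import Literature.MathematicalPhysics.QuantumFieldTheory.Balaban1983to89.B11Eq98V0primeCurrentSlots
import Literature.MathematicalPhysics.QuantumFieldTheory.Balaban1983to89.B12Lemma4Models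
import HarnessLib

/-!
# `Balaban1983to89.Node00.BgRemainderOfRecord` — THE LETTERS OF (79)–(80)∕(110) PINNED AT THE RECORD, HESSIAN SLOT A DATUM:
# `Δ_{1,a}(U₀; Δ₁)`, `𝔊(U₀; Δ₁)`, `H₁(U₀; Δ₁)` slot-generic; print's `π = 1 − DG′RD*`; the two typed readings of (3.119) `Δ_π`; the slot-(c)
# Hessian `π†(Δ(U₀) + Δ⁽²⁾)π` of [B9] (3.128)∕(3.135) with `Δ⁽²⁾` a datum and (3.124) for it; the dualising letters `ρ`, `τ`; and the
# record's `𝔊(U₀)`, `H₁(U₀)`, `𝔄 = H₁B` (103) and `W` of (80)∕(84)–(96) = lit's `B11Eq80Current.W80` with every slot a letter of record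
# — OURS (definitional + bookkeeping∕gauge-mode theorems; file 3f′ of the record-pinned instance road `M2`; no inequality of Bałaban)

Cell `pub-ymgap`, unit `pub-ymgap-node00-def-Y` (g37; owner∕custodian of the `OpsY` instance at the record; Node00 definition lane;
`--kind definition --supports stmt-QuantumFields-27238`; count-neutral).  [B11] = [Balaban1985Variational] = T. Bałaban, *The variational
problem and background fields in renormalization group method for lattice gauge theories*, Commun. Math. Phys. **102** (1985) 277–309 (held
`paper:balaban1985-cmp102-variational-background`; journal page = PDF page + 276; pp. 285, 290–294 reread 2026-08-31).  [B9] =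
[Balaban1985BackgroundPropagators] = *Propagators for lattice gauge theories in a background field*, Commun. Math. Phys. **99** (1985) 389–434.

WHY THIS FILE (M2 plan v2 §4, file 3f′; review seat RR-2's CHECK-Δ word (R-Δ1)–(R-Δ5)).  Print has THREE occupants for the Hessian slot `Δ₁` of
(110)'s operator `Δ₁ + DRD* + aQ*Q` whose inverse is `G₁`: (a) the bare Hessian `Δ(U₀)` of [B9] (3.10)∕(3.26) (`hessOpOfRecord`; the letters of
files 3a–3c: `laplaceAOfRecord`, `frakGOfRecord(AtBg∕AtBgFlat)`, `H1OfRecord(AtBgFlat)`); (b) the gauge-invariant extension `Δ_π` of (3.119) in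
(3.122)'s `𝒢̃`; (c) `Δ_π + Δ⁽²⁾_π` of (3.128) = [B11] (79), the quadratic form actually inverted in (110) and paired with lit's `E3`∕`W80` of
(78)–(80).  This file makes the slot a DATUM — ONE slot-generic handle each for `Δ_{1,a}`, `𝔊`, `H₁` (§1; `rfl` to the 3a letters at
`Δ₁ := hessOpOfRecord`) — types print's projection `π_{U₀} = 1 − D G′ R D*` with the (3.24)–(3.25) Green's function `G′` a LETTER `Gp` (§2),
NAMES the two typed readings of (3.119) (R-Δ4): the HILBERT-ADJOINT `π†Δπ` (`hessOpOfRecordPi`; the `𝒢`-slot's, where positivity `hpos` and the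
inverse `G₁` live on the Hilbert space `L²`) and the BILINEAR-TRANSPOSE `πᵗΔπ` of lit `B9Eq3119DeltaPiCarrier.deltaPi` (`hessOpOfRecordPiT`; the
W₇ letter `Δπ` of (80), a current-valued map `DeltaPiCurOfRecord` via lit `currentCLM`), types the slot-(c) Hessian `π†(Δ(U₀) + Δ⁽²⁾)π`
((3.135): `Δ⁽²⁾_π = TᵀΔ⁽²⁾T`) with the second-order operator `Δ⁽²⁾` a DATUM `Δ2` (§4), proves its (g1) letter «`(Δ_π + Δ⁽²⁾_π)Dλ = 0` on
`N(Q′)`» from (g5) and bridges by `rfl` to the Summit-side (3.124) assembly of record (cited, not re-derived) — then pins the record's `𝔊(U₀)`,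
`H₁(U₀)`, `𝔄 = H₁B` at `(Q(U₀), Q′♭)` for slot (c) and the remainder current `W` of (80) with `C` on the TRACELESS slice (§0, §5), the `𝒢`-,
`𝔄`- and `W`-slots of the scheme `BgScheme` (file 3g′ assembles the instance).

DICTIONARY (print ↦ here).  (110) `Δ₁ + DRD* + aQ*Q` with `Δ₁` a datum ↦ `laplaceAOfRecordAt Δ₁ Q Q′ a` (lit `laplaceALatticeK` at the
record's `c = cRec`, transporters `RRec`∕`SRec`, `R = RrOfRecord Q′`); `𝔊 = G₁𝔓*` (111)∕(116) ↦ `frakGOfRecordAt Δ₁ Q Q′ a hpos hQ` (lit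
`frakGLatticeCLM`); `H₁ = G₁Q*(QG₁Q*)⁻¹` (102)–(103) ↦ `H1OfRecordAt levB Δ₁ Q Q′ a hpos hQ` (lit `H1LatticeCLM`); [B9] p. 419 `π = A − DG′RD*A`
↦ `piOfRecord Gp Q′ := 1 − D ∘ Gp ∘ R ∘ D*`; (3.119) `Δ_π` ↦ `hessOpOfRecordPi Gp Q′ := π† ∘ Δ(U₀) ∘ π` (𝒢-slot) ∕ `hessOpOfRecordPiT Gp Q′ :=
deltaPi (phiRec N) π Δ(U₀)` (W₇); the letter `Δπ` of (80) ↦ `DeltaPiCurOfRecord Gp Q′ := currentCLM (phiRec N) (pairLevLit …) (nabla115 …)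
(hessOpOfRecordPiT …)`; (3.128)∕(3.135) `Δ_π + Δ⁽²⁾_π` ↦ `hessOpOfRecord128 Gp Q′ Δ2 := π† ∘ (Δ(U₀) + Δ2) ∘ π`; `τ = tr` ↦ `tauRecCLM`; the
dualising map of (27) ↦ `rhoRec := rieszτ (phiRec N)` (lit `B11Eq98V0primeCurrentSlots`), `τ(ρ(ℓ)X) = ℓ X` ↦ `tauRecCLM_rhoRec_mul`; the record's
`𝔊(U₀)`, `H₁(U₀)`, `𝔄(V) = H₁B(V)` for slot (c) at `(Q(U₀), Q′♭)` ↦ `frakGOfRecordAtBg128`, `H1OfRecordAtBg128`, `frakAOfRecordAtBg128` (`B =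
BOfRecord` (20), file 3e′); `W = W₁ + W₂ + W₃ + (90)–(96)∘(47)` (84)–(96) ↦ `WOfRecordAt levB a hpos hQ εC Gp := B11Eq80Current.W80 (rhoRec N)
(tauRecCLM N) (unitsOfRecord F N U₀) (H1OfRecordAtBgFlat …) (CslOfRecord …) εC (JOfRecordAtBg …) (DeltaPiCurOfRecord … Gp Q′♭)` — Sect. C's `H`
of (45)–(47) := the flat-letter `H₁♭` of file 3c (a right inverse of `Q(U₀)`, which is all (45) asks: slot (a) is legitimate THERE), `C := CslOfRecord`
((44) on the slice: 3e′'s `COfRecord ∘ slProjLit`, §0), `J := JOfRecordAtBg` (28).  Lit r08's `B11Eq81Expansion` carries (79) with `Δ₁ = Δπ − Δπ2`, `Δπ2 = −Δ⁽²⁾_π`, and the defining identity of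
`Δ⁽²⁾_π` as the hypothesis `h3127`; here `Δ⁽²⁾` is the datum `Δ2` and that identity (with `C⁽²⁾` the quadratic part of `CslOfRecord`, `J = JOfRecordAtBg`, `H`) is a
displayed token of file 3g′.

CONTENTS.
* §1 `laplaceAOfRecordAt`, `frakGOfRecordAt`, `H1OfRecordAt` (slot-generic) + `_hessOpOfRecord` (`rfl` to files 3a∕3c).
* §2 `piOfRecord`; **`piOfRecord_gaugeMode`** (π kills `D_{U₀}λ`, `λ ∈ N(Q′)`, from (g5) alone — lit `printProjectionLattice_gaugeMode`);
  `piOfRecord_greenK_gaugeMode` ((g5) discharged for `Gp := greenK T′`, lit `printGreen_gaugeMode`); `hessOpOfRecordPi`, `hessOpOfRecordPiT`,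
  `DeltaPiCurOfRecord`.
* §3 `tauRecCLM` (`_apply`, `_mul_comm`), `rhoRec`, **`tauRecCLM_rhoRec_mul`** (the `hρ` of lit `pair27_W80`, by `inner_phiRec_symm` + lit
  `trace_rieszτ_mul`).
* §4 `hessOpOfRecord128` (`_zero`: `Δ2 := 0` is slot (b); `_eq_add`; **`_gaugeMode`** = the (g1) letter of the slot at ANY `G′`, `Q′`, from
  (g5) by lit `invariantExtension_apply_eq_zero`); `piOfRecord_eq` ∕ `hessOpOfRecord128_eq` — `rfl` bridges to the literal `1 − DG′RD*` ∕
  `π†(Δ + Δ⁽²⁾)π` shapes over which the Summit-side (3.124) assembly of record (`Q_G1_covDeriv_Rr_ofRecord_pi`, `Rr_covDiv_G1_covDeriv_Rr_ofRecord_pi`,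
  `Rr_covDiv_G1_adjointQ_ofRecord_pi`, any `Δ`, `G′ := greenK T′`) is stated: (3.124) `QG̃₁DR = 0`, p. 425 `RD*G̃₁DR = R`, `RD*G̃₁Q* = 0` are CITED
  from there with `Δ := Δ(U₀) + Δ2`, not re-derived (lit route by name: `B9Eq3124GaugeModes.h124_RLatticeK ∕ hRDR_RLatticeK ∕ h124'_RLatticeK` from
  (g1) = `hessOpOfRecord128_gaugeMode`, (g2), `conj_cRec`, `inner_RRec_left`, symmetry of `Δ(U₀) + Δ⁽²⁾` — the three displayed letters of lit
  `frakGLatticeCLM_mem_constraint102`, (117) `Q𝔊 = 0, RD*𝔊 = 0`).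
* §0 `slProjLit` (the fibrewise traceless projection `P` on the space (115) as a CLM; `equiv_slProjLit`, `evLit_slProjLit` (`rfl`),
  `trace_equiv_slProjLit`, `slProjLit_of_trace_eq_zero`, `slProjLit_slProjLit`) and, in §5, **`CslOfRecord := COfRecord ∘ P`** (`_apply`,
  `_of_trace_eq_zero`, `_zero`, `analyticAt_CslOfRecord_zero`) — `C` on print's `𝔤ᶜ`-valued slice, the `C`-slot of `W` and of every (44)-token.
* §5 `frakGOfRecordAtBg128`, `H1OfRecordAtBg128`, `frakAOfRecordAtBg128` (`_eq`, `_self`: `𝔄(Ū^kU₀) = 0` by 3e′'s `BOfRecord_self`),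
  `Q_H1OfRecordAtBg128` ((45) `Q(H₁B) = B`, hypothesis-free, lit `Q_H1LatticeCLM`), **`WOfRecordAt`** (`_eq`: `= W1 + W2 + W3 + curV0full`, `rfl`).

HONEST LABELS.  Definitional letters and bookkeeping ∕ gauge-mode identities only.  NOT asserted here: [B9] Thm 3.11∕3.12 (the displayed
`hpos` for any slot; Thm 3.12's perturbation series (3.130)∕(3.138) are lit's `B9Eq3120StepDelta1Pi`, `B9Eq3130Neumann`, `B9Eq3138StepDelta2Pi`,
`B9Eq3138FirstFactors`, `B9Carve10Thm312toAppCHyp` by name), (g2) at `(Q(U₀), Q′♭)` (displayed; the Summit-side theorem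
`QOfRecord_covDerivL2K_eq_zero_of_QflatOfRecord_eq_zero` under `SmallBelow`), (g5) for a given `G′` (displayed; discharged for `greenK T′`),
the symmetry of `Δ(U₀)` off the flat orbit, the (3.128) identity defining `Δ⁽²⁾` (a token of file 3g′), (46) `|HB| ≤ B₂|B|`, (117)'s bound
`B₀` (Thm 3.13), the Sect. C regime ∕ (63) certificate `pair27_W80` for `WOfRecordAt` (its hypotheses `hτ`, `hρ` are `tauRecCLM_mul_comm`,
`tauRecCLM_rhoRec_mul`; `hΔ`, the regime and `Prop4Hyp` are the prover's, STATED OVER `CslOfRecord` — every displayed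
`Regime`∕`Prop4Hyp`∕`QuadAnalytic` token of this lane reads `C := CslOfRecord`, never the bare `COfRecord`), and any `∃` over scheme data.  ERRATUM
carried for file 3e′ (its docstring's tokens «`fderiv ℂ C 0 = 0`», «`|C(A′)| ≤ C₂|A′|²`»): read «on `𝔰𝔩(N)`-valued `A′` (print's `𝔤ᶜ`, (51))», i.e. for
`CslOfRecord`; 3e′'s DEFINITIONS are total and unchanged.  No `sorry`, no new axiom, no instance ∕ notation.  Nothing here is a claim about the Yang–Mills mass gap (`Summit.QuantumFields`): finite torus, fixed `ε`; nothing continuum ∕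
OS ∕ Clay.
-/

noncomputable section

open scoped Matrix Matrix.Norms.L2Operator InnerProductSpace ComplexConjugate

namespace Literature.MathematicalPhysics.QuantumFieldTheory.Balaban1983to89.Node00

open T4Continuum
open B9SectCLatticeCarrier (Bond)
open B9Eq311L2Pairing (WL2)
open B11Eq103H1Complex (BondL2K SiteL2K laplaceALatticeK covDerivL2K covDivL2K covLaplaceSiteK RLatticeK G1LatticeK frakGLatticeCLM H1LatticeCLM
  readFun)
open B11Eq111FrakG (nabla115 jetLinearEquiv)
open B11Eq115Space (NegSize NegSup JetSup)
open B9Eq3119DeltaPiCarrier (deltaPi currentCLM)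
open B11Eq98V0primeCurrentSlots (rieszτ trace_rieszτ_mul)
open B9Eq3119InvariantExtension (invariantExtension_apply_eq_zero)
open B12Lemma4Models (slProj slProj_apply trace_slProj slProj_of_trace_eq_zero slProj_slProj)

section Slots

variable (F : T4Family) (N : ℕ) {K : ℕ} (k : ℕ) (Ω : ℕ → Set (Site (F.P K) 0)) (U₀ : GaugeField (F.P K) 0 (SU N))
  {β : Type*} [Fintype β] {wB : β → ℝ} [Fact (∀ y, 0 < wB y)] {F' : Type*} [AddCommGroup F'] [Module ℂ F']

/-! ## §0. Print's `𝔤ᶜ = 𝔰𝔩(N, ℂ)`-valued fields inside the `M_N(ℂ)`-fibre carrier: the traceless projection on the space (115) and `C` on the slice -/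

variable (K) in
/-- **THE FIBREWISE TRACELESS PROJECTION ON THE SPACE (115)**: `(P A′)(b) = π(A′(b))`, `π X = X − N⁻¹(tr X)·1` (lit `B12Lemma4Models.slProj`, print's
«projection onto the algebra 𝔤ᶜ», [Balaban1987RG1] (1.8)), as a continuous linear map of the record's carrier (continuity is automatic on the finite
lattice).  WHY ([B11] (51) p. 286: the fields `A′` are `𝔤ᶜ`-valued): the carrier `Space115Lit` has fibre `M_N(ℂ) = 𝔤𝔩(N)`, and file 3e′'s `COfRecord` —
built on lit's adjugate-continued averaging `iterMh` — is LINEAR, not quadratic, along the scalar directions `A′ = a·1` (review seats n07-w3 ∕ RR-2,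
2026-08-31: on `c·U₀`, `|c| = 1`, a closed (0.4) loop with `g ≥ L` backward steps picks up `c^{Ng}`), so print's (44) «`|C(A′)| ≤ C₂|A′|²`» and every
`Regime`∕`Prop4Hyp`-shaped token are inhabitable only on the traceless slice; composing with `P` (below, `CslOfRecord`) puts the tokens there without
re-typing 3e′. [cite: Balaban1985Variational, (51) p.286, (44) p.285; Balaban1987RG1, (1.8) p.261] -/
def slProjLit [Fact (0 < (F.L : ℝ))] [Fact (0 < (F.P K).eta k)] : Space115Lit F N K k Ω U₀ →L[ℂ] Space115Lit F N K k Ω U₀ :=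
  LinearMap.toContinuousLinearMap
    ((jetLinearEquiv (F.L : ℝ) ((F.P K).eta k) (bondLevLit F Ω k) (pairLevLit F Ω k) (nabla115 ((F.P K).eta k) (unitsOfRecord F N U₀))).symm.toLinearMap ∘ₗ
      (slProj N).compLeft (Bond (F.P K).d (fun _ => (F.P K).sitesPerDir 0)) ∘ₗ
      (jetLinearEquiv (F.L : ℝ) ((F.P K).eta k) (bondLevLit F Ω k) (pairLevLit F Ω k) (nabla115 ((F.P K).eta k) (unitsOfRecord F N U₀))).toLinearMap)

variable (K) in
/-- Unfolding: the function underlying `P A′` is `b ↦ π(A′(b))`. [cite: Balaban1985Variational, (51) p.286 (bookkeeping)] -/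
theorem equiv_slProjLit [Fact (0 < (F.L : ℝ))] [Fact (0 < (F.P K).eta k)] (A : Space115Lit F N K k Ω U₀) (b : Bond (F.P K).d (fun _ => (F.P K).sitesPerDir 0)) :
    JetSup.equiv _ _ _ (slProjLit F N K k Ω U₀ A) b = slProj N (JetSup.equiv _ _ _ A b) := rfl

variable (K) in
/-- `ev(P A′)(c) = π(ev A′ (c))` on the record's bonds. [cite: Balaban1985Variational, (19) p.281, (51) p.286 (bookkeeping)] -/
theorem evLit_slProjLit [Fact (0 < (F.L : ℝ))] [Fact (0 < (F.P K).eta k)] (A : Space115Lit F N K k Ω U₀) (c : PBond (F.P K) 0) :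
    evLit F N K k Ω U₀ (slProjLit F N K k Ω U₀ A) c = slProj N (evLit F N K k Ω U₀ A c) := rfl

variable (K) in
/-- `P A′` is traceless at every bond. [cite: Balaban1985Variational, (51) p.286] -/
theorem trace_equiv_slProjLit [NeZero N] [Fact (0 < (F.L : ℝ))] [Fact (0 < (F.P K).eta k)] (A : Space115Lit F N K k Ω U₀)
    (b : Bond (F.P K).d (fun _ => (F.P K).sitesPerDir 0)) : (JetSup.equiv _ _ _ (slProjLit F N K k Ω U₀ A) b).trace = 0 := by
  rw [equiv_slProjLit]; exact trace_slProj _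

variable (K) in
/-- `P` fixes the traceless fields (print's `𝔤ᶜ`-valued `A′`). [cite: Balaban1985Variational, (51) p.286] -/
theorem slProjLit_of_trace_eq_zero [Fact (0 < (F.L : ℝ))] [Fact (0 < (F.P K).eta k)] {A : Space115Lit F N K k Ω U₀}
    (hA : ∀ b, (JetSup.equiv _ _ _ A b).trace = 0) : slProjLit F N K k Ω U₀ A = A := by
  apply (JetSup.equiv _ _ (nabla115 ((F.P K).eta k) (unitsOfRecord F N U₀))).injective
  funext b
  rw [equiv_slProjLit, slProj_of_trace_eq_zero (hA b)]

variable (K) in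
/-- `P` is idempotent. [cite: Balaban1985Variational, (51) p.286 (bookkeeping)] -/
theorem slProjLit_slProjLit [Fact (0 < (F.L : ℝ))] [Fact (0 < (F.P K).eta k)] (A : Space115Lit F N K k Ω U₀) :
    slProjLit F N K k Ω U₀ (slProjLit F N K k Ω U₀ A) = slProjLit F N K k Ω U₀ A := by
  apply (JetSup.equiv _ _ (nabla115 ((F.P K).eta k) (unitsOfRecord F N U₀))).injective
  funext b
  rw [equiv_slProjLit, equiv_slProjLit, slProj_slProj]

/-! ## §1. The Hessian slot `Δ₁` as a DATUM: `Δ_{1,a}(U₀; Δ₁)`, `𝔊(U₀; Δ₁)`, `H₁(U₀; Δ₁)` -/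

/-- **(110)'s `Δ_{1,a}(U₀) = Δ₁ + DRD* + aQ*Q` WITH THE HESSIAN SLOT `Δ₁` A DATUM** (print has three occupants for it: [B9] (3.26) bare `Δ(U₀)`,
(3.119)∕(3.122) `Δ_π`, and (3.128)∕(3.138) = [B11] (79) `Δ_π + Δ⁽²⁾_π`); `laplaceAOfRecord` (file NE9-record) is this at `Δ₁ := hessOpOfRecord` (`rfl`).
[cite: Balaban1985Variational, (79) p.290, (110) p.294; Balaban1985BackgroundPropagators, (3.26) p.395, (3.119) p.419, (3.128) p.421] -/
abbrev laplaceAOfRecordAt [Fact (0 < c0Rec F K k)]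
    (Δ₁ : BondL2K ℂ (F.P K).d (fun _ => (F.P K).sitesPerDir 0) (c0Rec F K k) (WRec N) →ₗ[ℂ]
      BondL2K ℂ (F.P K).d (fun _ => (F.P K).sitesPerDir 0) (c0Rec F K k) (WRec N))
    (Q : BondL2K ℂ (F.P K).d (fun _ => (F.P K).sitesPerDir 0) (c0Rec F K k) (WRec N) →ₗ[ℂ] WL2 ℂ wB (WRec N))
    (Q' : SiteL2K ℂ (F.P K).d (fun _ => (F.P K).sitesPerDir 0) (c0Rec F K k) (WRec N) →ₗ[ℂ] F') (a : ℝ) :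
    BondL2K ℂ (F.P K).d (fun _ => (F.P K).sitesPerDir 0) (c0Rec F K k) (WRec N) →ₗ[ℂ]
      BondL2K ℂ (F.P K).d (fun _ => (F.P K).sitesPerDir 0) (c0Rec F K k) (WRec N) :=
  laplaceALatticeK (cRec F K k) (RRec F N U₀) (SRec F N U₀) Δ₁ (RrOfRecord F N k U₀ Q') Q a

/-- At `Δ₁ := hessOpOfRecord` the slot handle IS `laplaceAOfRecord` (`rfl`). [cite: Balaban1985Variational, (110) p.294 (bookkeeping)] -/
theorem laplaceAOfRecordAt_hessOpOfRecord [Fact (0 < c0Rec F K k)]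
    (Q : BondL2K ℂ (F.P K).d (fun _ => (F.P K).sitesPerDir 0) (c0Rec F K k) (WRec N) →ₗ[ℂ] WL2 ℂ wB (WRec N))
    (Q' : SiteL2K ℂ (F.P K).d (fun _ => (F.P K).sitesPerDir 0) (c0Rec F K k) (WRec N) →ₗ[ℂ] F') (a : ℝ) :
    laplaceAOfRecordAt F N k U₀ (hessOpOfRecord F N k U₀) Q Q' a = laplaceAOfRecord F N k U₀ Q Q' a := rfl

variable (K) in
/-- **`𝔊(U₀; Δ₁)` — the `𝒢`-slot letter with the Hessian slot a datum** (lit's constructed `frakGLatticeCLM` at the record's fibre ∕ transporters; data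
`Δ₁, Q, Q′, a`; displayed proofs `hpos` (positivity of `Δ_{1,a}(U₀; Δ₁)`, [B9] Thms 3.11∕3.12 for the slot in play) and `hQ`).
[cite: Balaban1985Variational, (110)–(111) p.294, (116)–(117) p.295; Balaban1985BackgroundPropagators, Thm 3.11 p.416, Thm 3.12 p.421] -/
def frakGOfRecordAt [Fact (0 < (F.L : ℝ))] [Fact (0 < (F.P K).eta k)] [Fact (0 < c0Rec F K k)]
    (Δ₁ : BondL2K ℂ (F.P K).d (fun _ => (F.P K).sitesPerDir 0) (c0Rec F K k) (WRec N) →ₗ[ℂ]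
      BondL2K ℂ (F.P K).d (fun _ => (F.P K).sitesPerDir 0) (c0Rec F K k) (WRec N))
    (Q : BondL2K ℂ (F.P K).d (fun _ => (F.P K).sitesPerDir 0) (c0Rec F K k) (WRec N) →ₗ[ℂ] WL2 ℂ wB (WRec N))
    (Q' : SiteL2K ℂ (F.P K).d (fun _ => (F.P K).sitesPerDir 0) (c0Rec F K k) (WRec N) →ₗ[ℂ] F') (a : ℝ)
    (hpos : ∀ x, x ≠ 0 → 0 < RCLike.re ⟪x, laplaceAOfRecordAt F N k U₀ Δ₁ Q Q' a x⟫_ℂ) (hQ : Function.Surjective Q) :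
    NegSizeLit F N K k Ω 3 →L[ℂ] Space115Lit F N K k Ω U₀ :=
  frakGLatticeCLM (phiRec N) hpos hQ (pairLevLit F Ω k) (nabla115 ((F.P K).eta k) (unitsOfRecord F N U₀))

variable (K) in
/-- At the bare slot `Δ₁ := hessOpOfRecord` this is `frakGOfRecord` (`rfl`). [cite: Balaban1985Variational, (111) p.294 (bookkeeping)] -/
theorem frakGOfRecordAt_hessOpOfRecord [Fact (0 < (F.L : ℝ))] [Fact (0 < (F.P K).eta k)] [Fact (0 < c0Rec F K k)]
    (Q : BondL2K ℂ (F.P K).d (fun _ => (F.P K).sitesPerDir 0) (c0Rec F K k) (WRec N) →ₗ[ℂ] WL2 ℂ wB (WRec N))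
    (Q' : SiteL2K ℂ (F.P K).d (fun _ => (F.P K).sitesPerDir 0) (c0Rec F K k) (WRec N) →ₗ[ℂ] F') (a : ℝ)
    (hpos : ∀ x, x ≠ 0 → 0 < RCLike.re ⟪x, laplaceAOfRecord F N k U₀ Q Q' a x⟫_ℂ) (hQ : Function.Surjective Q) :
    frakGOfRecordAt F N K k Ω U₀ (hessOpOfRecord F N k U₀) Q Q' a hpos hQ = frakGOfRecord F N K k Ω U₀ Q Q' a hpos hQ := rfl

variable (K) in
/-- **`H₁(U₀; Δ₁)` — the (102)–(103) letter `G₁Q*(QG₁Q*)⁻¹` with the Hessian slot a datum**, block levels `levB` a datum.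
[cite: Balaban1985Variational, (45) p.285, (102)–(103) p.293] -/
def H1OfRecordAt [Fact (0 < (F.L : ℝ))] [Fact (0 < (F.P K).eta k)] [Fact (0 < c0Rec F K k)] (levB : β → ℕ)
    (Δ₁ : BondL2K ℂ (F.P K).d (fun _ => (F.P K).sitesPerDir 0) (c0Rec F K k) (WRec N) →ₗ[ℂ]
      BondL2K ℂ (F.P K).d (fun _ => (F.P K).sitesPerDir 0) (c0Rec F K k) (WRec N))
    (Q : BondL2K ℂ (F.P K).d (fun _ => (F.P K).sitesPerDir 0) (c0Rec F K k) (WRec N) →ₗ[ℂ] WL2 ℂ wB (WRec N))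
    (Q' : SiteL2K ℂ (F.P K).d (fun _ => (F.P K).sitesPerDir 0) (c0Rec F K k) (WRec N) →ₗ[ℂ] F') (a : ℝ)
    (hpos : ∀ x, x ≠ 0 → 0 < RCLike.re ⟪x, laplaceAOfRecordAt F N k U₀ Δ₁ Q Q' a x⟫_ℂ) (hQ : Function.Surjective Q) :
    NegSize (F.L : ℝ) ((F.P K).eta k) levB 0 (Matrix (Fin N) (Fin N) ℂ) →L[ℂ] Space115Lit F N K k Ω U₀ :=
  H1LatticeCLM (phiRec N) hpos hQ (pairLevLit F Ω k) (nabla115 ((F.P K).eta k) (unitsOfRecord F N U₀))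

variable (K) in
/-- At the bare slot this is `H1OfRecord` (`rfl`). [cite: Balaban1985Variational, (103) p.293 (bookkeeping)] -/
theorem H1OfRecordAt_hessOpOfRecord [Fact (0 < (F.L : ℝ))] [Fact (0 < (F.P K).eta k)] [Fact (0 < c0Rec F K k)] (levB : β → ℕ)
    (Q : BondL2K ℂ (F.P K).d (fun _ => (F.P K).sitesPerDir 0) (c0Rec F K k) (WRec N) →ₗ[ℂ] WL2 ℂ wB (WRec N))
    (Q' : SiteL2K ℂ (F.P K).d (fun _ => (F.P K).sitesPerDir 0) (c0Rec F K k) (WRec N) →ₗ[ℂ] F') (a : ℝ)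
    (hpos : ∀ x, x ≠ 0 → 0 < RCLike.re ⟪x, laplaceAOfRecord F N k U₀ Q Q' a x⟫_ℂ) (hQ : Function.Surjective Q) :
    H1OfRecordAt F N K k Ω U₀ levB (hessOpOfRecord F N k U₀) Q Q' a hpos hQ = H1OfRecord F N K k Ω U₀ levB Q Q' a hpos hQ := rfl

/-! ## §2. Print's `π = 1 − DG′RD*`, the two typed readings of (3.119) `Δ_π`, and the W₇ letter `Δπ` of (80) -/

/-- **PRINT'S PROJECTION `π_{U₀} = 1 − D G′ R D*` OF [B9] p. 419** at the record's transporters, with the (3.24)–(3.25) Green's function `G′`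
a LETTER `Gp` and `R := RrOfRecord Q′`. [cite: Balaban1985BackgroundPropagators, (3.119) p.419, (3.24)–(3.25) p.394] -/
def piOfRecord [Fact (0 < c0Rec F K k)]
    (Gp : SiteL2K ℂ (F.P K).d (fun _ => (F.P K).sitesPerDir 0) (c0Rec F K k) (WRec N) →ₗ[ℂ]
      SiteL2K ℂ (F.P K).d (fun _ => (F.P K).sitesPerDir 0) (c0Rec F K k) (WRec N))
    (Q' : SiteL2K ℂ (F.P K).d (fun _ => (F.P K).sitesPerDir 0) (c0Rec F K k) (WRec N) →ₗ[ℂ] F') :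
    BondL2K ℂ (F.P K).d (fun _ => (F.P K).sitesPerDir 0) (c0Rec F K k) (WRec N) →ₗ[ℂ]
      BondL2K ℂ (F.P K).d (fun _ => (F.P K).sitesPerDir 0) (c0Rec F K k) (WRec N) :=
  LinearMap.id - covDerivL2K ℂ (c0Rec F K k) (cRec F K k) (RRec F N U₀) ∘ₗ Gp ∘ₗ RrOfRecord F N k U₀ Q' ∘ₗ
    covDivL2K ℂ (c0Rec F K k) (cRec F K k) (SRec F N U₀)

/-- **`π` KILLS THE `N(Q′)` GAUGE MODES** `D_{U₀}λ`, `Q′λ = 0`, from (g5) «`G′(Δ_{U₀}λ) = λ` on `N(Q′)`» alone (lit `printProjectionLattice_gaugeMode`).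
[cite: Balaban1985BackgroundPropagators, (3.119) p.419] -/
theorem piOfRecord_gaugeMode [Fact (0 < c0Rec F K k)]
    (Gp : SiteL2K ℂ (F.P K).d (fun _ => (F.P K).sitesPerDir 0) (c0Rec F K k) (WRec N) →ₗ[ℂ]
      SiteL2K ℂ (F.P K).d (fun _ => (F.P K).sitesPerDir 0) (c0Rec F K k) (WRec N))
    (Q' : SiteL2K ℂ (F.P K).d (fun _ => (F.P K).sitesPerDir 0) (c0Rec F K k) (WRec N) →ₗ[ℂ] F')
    (g5 : ∀ l, Q' l = 0 → Gp (covLaplaceSiteK (cRec F K k) (RRec F N U₀) (SRec F N U₀) l) = l)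
    {l : SiteL2K ℂ (F.P K).d (fun _ => (F.P K).sitesPerDir 0) (c0Rec F K k) (WRec N)} (hl : Q' l = 0) :
    piOfRecord F N k U₀ Gp Q' (covDerivL2K ℂ (c0Rec F K k) (cRec F K k) (RRec F N U₀) l) = 0 :=
  B9Eq3119InvariantExtension.printProjectionLattice_gaugeMode Gp g5 hl

/-- **(g5) DISCHARGED FOR PRINT'S `G′ = (Δ′_a)⁻¹`**: with `Gp := greenK T′` for any `T′` positive and agreeing with `Δ_{U₀} = D*D` on `N(Q′)` (as
(3.24)'s `Δ′_a = Δ_{U₀} + Q′*aQ′` does), `π` kills the gauge modes with no letter left (lit `printProjectionLattice_gaugeMode_greenK`).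
[cite: Balaban1985BackgroundPropagators, (3.24)–(3.25) p.394, (3.119) p.419] -/
theorem piOfRecord_greenK_gaugeMode [Fact (0 < c0Rec F K k)]
    (T' : SiteL2K ℂ (F.P K).d (fun _ => (F.P K).sitesPerDir 0) (c0Rec F K k) (WRec N) →ₗ[ℂ]
      SiteL2K ℂ (F.P K).d (fun _ => (F.P K).sitesPerDir 0) (c0Rec F K k) (WRec N))
    (hpos' : ∀ x, x ≠ 0 → 0 < RCLike.re ⟪x, T' x⟫_ℂ)
    (Q' : SiteL2K ℂ (F.P K).d (fun _ => (F.P K).sitesPerDir 0) (c0Rec F K k) (WRec N) →ₗ[ℂ] F')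
    (hT' : ∀ l, Q' l = 0 → T' l = covLaplaceSiteK (cRec F K k) (RRec F N U₀) (SRec F N U₀) l)
    {l : SiteL2K ℂ (F.P K).d (fun _ => (F.P K).sitesPerDir 0) (c0Rec F K k) (WRec N)} (hl : Q' l = 0) :
    piOfRecord F N k U₀ (B11Eq103H1Complex.greenK T' hpos') Q' (covDerivL2K ℂ (c0Rec F K k) (cRec F K k) (RRec F N U₀) l) = 0 :=
  piOfRecord_gaugeMode F N k U₀ _ Q' (fun _ hl => B9Eq3119InvariantExtension.printGreen_gaugeMode T' hpos' hT' hl) hl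

/-- **(3.119) `Δ_π(U₀) := π† ∘ Δ(U₀) ∘ π`, HILBERT-ADJOINT READING** — the occupant of the `𝒢`-slot's Hessian datum in [B9] (3.122) `G̃` (lit
`B9Eq3119InvariantExtension`, whose `h124_of_printExtension` gives (3.124) from (g2) + (g5)). [cite: Balaban1985BackgroundPropagators, (3.119) p.419, (3.122) p.420] -/
def hessOpOfRecordPi [Fact (0 < c0Rec F K k)]
    (Gp : SiteL2K ℂ (F.P K).d (fun _ => (F.P K).sitesPerDir 0) (c0Rec F K k) (WRec N) →ₗ[ℂ]
      SiteL2K ℂ (F.P K).d (fun _ => (F.P K).sitesPerDir 0) (c0Rec F K k) (WRec N))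
    (Q' : SiteL2K ℂ (F.P K).d (fun _ => (F.P K).sitesPerDir 0) (c0Rec F K k) (WRec N) →ₗ[ℂ] F') :
    BondL2K ℂ (F.P K).d (fun _ => (F.P K).sitesPerDir 0) (c0Rec F K k) (WRec N) →ₗ[ℂ]
      BondL2K ℂ (F.P K).d (fun _ => (F.P K).sitesPerDir 0) (c0Rec F K k) (WRec N) :=
  LinearMap.adjoint (piOfRecord F N k U₀ Gp Q') ∘ₗ hessOpOfRecord F N k U₀ ∘ₗ piOfRecord F N k U₀ Gp Q'

/-- **(3.119) `Δ_π := πᵗ Δ π`, BILINEAR-TRANSPOSE READING** (lit `B9Eq3119DeltaPiCarrier.deltaPi`: the operator of the bilinear form `(πA, Δ πB)`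
for the trace pairing (27)) — the reading the W₇ letter `Δπ` of (80) uses. [cite: Balaban1985BackgroundPropagators, (3.119) p.419; Balaban1985Variational, (80) p.290] -/
def hessOpOfRecordPiT [Fact (0 < c0Rec F K k)]
    (Gp : SiteL2K ℂ (F.P K).d (fun _ => (F.P K).sitesPerDir 0) (c0Rec F K k) (WRec N) →ₗ[ℂ]
      SiteL2K ℂ (F.P K).d (fun _ => (F.P K).sitesPerDir 0) (c0Rec F K k) (WRec N))
    (Q' : SiteL2K ℂ (F.P K).d (fun _ => (F.P K).sitesPerDir 0) (c0Rec F K k) (WRec N) →ₗ[ℂ] F') :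
    BondL2K ℂ (F.P K).d (fun _ => (F.P K).sitesPerDir 0) (c0Rec F K k) (WRec N) →ₗ[ℂ]
      BondL2K ℂ (F.P K).d (fun _ => (F.P K).sitesPerDir 0) (c0Rec F K k) (WRec N) :=
  deltaPi (phiRec N) (piOfRecord F N k U₀ Gp Q') (hessOpOfRecord F N k U₀)

variable (K) in
/-- **THE W₇ LETTER `Δπ` OF (80) AT THE RECORD**: the `|·|₍₋₃₎`-current-valued map `A′ ↦ Δ_π A′` on the space (115) (lit `currentCLM` of the
bilinear-transpose `Δ_π`) — the `Δπ`-slot of lit's `B11Eq80Current.W2 ∕ W3 ∕ W80`. [cite: Balaban1985Variational, (80) p.290, (88)–(89) p.291] -/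
def DeltaPiCurOfRecord [Fact (0 < (F.L : ℝ))] [Fact (0 < (F.P K).eta k)] [Fact (0 < c0Rec F K k)]
    (Gp : SiteL2K ℂ (F.P K).d (fun _ => (F.P K).sitesPerDir 0) (c0Rec F K k) (WRec N) →ₗ[ℂ]
      SiteL2K ℂ (F.P K).d (fun _ => (F.P K).sitesPerDir 0) (c0Rec F K k) (WRec N))
    (Q' : SiteL2K ℂ (F.P K).d (fun _ => (F.P K).sitesPerDir 0) (c0Rec F K k) (WRec N) →ₗ[ℂ] F') :
    Space115Lit F N K k Ω U₀ →L[ℂ] NegSizeLit F N K k Ω 3 :=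
  currentCLM (phiRec N) (pairLevLit F Ω k) (nabla115 ((F.P K).eta k) (unitsOfRecord F N U₀)) (hessOpOfRecordPiT F N k U₀ Gp Q')

/-! ## §3. The dualising letters `ρ`, `τ` of (27)∕(84) at the record's fibre -/

/-- **`τ = tr`** as a continuous functional (the `τ`-slot of lit's (84)–(96) currents). [cite: Balaban1985Variational, (27) p.282; Balaban1985Averaging, (18) p.21] -/
def tauRecCLM : Matrix (Fin N) (Fin N) ℂ →L[ℂ] ℂ := LinearMap.toContinuousLinearMap (tauRec N)

/-- Unfolding `τ`. [cite: Balaban1985Variational, (27) p.282 (bookkeeping)] -/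
theorem tauRecCLM_apply (X : Matrix (Fin N) (Fin N) ℂ) : tauRecCLM N X = Matrix.trace X := rfl

/-- `τ` is tracial: `τ(XY) = τ(YX)`. [cite: Balaban1985Variational, (27) p.282 (bookkeeping)] -/
theorem tauRecCLM_mul_comm (X Y : Matrix (Fin N) (Fin N) ℂ) : tauRecCLM N (X * Y) = tauRecCLM N (Y * X) := Matrix.trace_mul_comm X Y

/-- **`ρ`** — the dualising map of the bilinear trace pairing (27) at the record's Hilbert fibre (lit `rieszτ` along `phiRec`): the `ρ`-slot of (84)–(96).
[cite: Balaban1985Variational, (27) p.282, (84) p.290; Balaban1985Averaging, (18) p.21] -/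
def rhoRec : (Matrix (Fin N) (Fin N) ℂ →L[ℂ] ℂ) →L[ℂ] Matrix (Fin N) (Fin N) ℂ := rieszτ (phiRec N)

/-- **`τ(ρ(ℓ)·X) = ℓ(X)`** — the dualising identity (the `hρ` of lit's `pair27_W80`), DISCHARGED at the record by `inner_phiRec_symm`.
[cite: Balaban1985Variational, (27) p.282, (84) p.290] -/
theorem tauRecCLM_rhoRec_mul (ℓ : Matrix (Fin N) (Fin N) ℂ →L[ℂ] ℂ) (X : Matrix (Fin N) (Fin N) ℂ) : tauRecCLM N (rhoRec N ℓ * X) = ℓ X :=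
  trace_rieszτ_mul (phiRec N) (tauRecCLM N) (fun X Y => inner_phiRec_symm X Y) ℓ X

/-! ## §4. [B9] (3.128)∕(3.135): the slot-(c) Hessian `Δ_π + Δ⁽²⁾_π = π†(Δ + Δ⁽²⁾)π` with `Δ⁽²⁾` a DATUM, and (3.124) for it -/

/-- **THE HESSIAN SLOT OF (79)∕(110) = [B9] (3.128): `Δ₁ = Δ_π + Δ⁽²⁾_π = π†(Δ(U₀) + Δ⁽²⁾)π`** ((3.135): `Δ⁽²⁾_π = TᵀΔ⁽²⁾T`, `T = π`), Hilbert
reading, with the second-order operator `Δ⁽²⁾` a DATUM `Δ2` (its defining identity «the second quadratic form in (3.128)», `⟨HC⁽²⁾(A′), J⟩` of (78)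
with `C⁽²⁾ = C2OfRecord` (file 3e′), `J = JOfRecordAtBg` (3d′), is DISPLAYED where consumed — lit r08's `B11Eq81Expansion.eq79` carries it as the
hypothesis `h3127` with the dictionary `Δπ2 = −Δ⁽²⁾_π`; no formula for `Δ⁽²⁾` is asserted here). `Δ2 := 0` is the slot (b) `Δ_π` of (3.119)∕(3.122).
[cite: Balaban1985BackgroundPropagators, (3.128) p.421, (3.135) p.422, (3.119) p.419; Balaban1985Variational, (79) p.290, (110) p.294] -/
def hessOpOfRecord128 [Fact (0 < c0Rec F K k)]
    (Gp : SiteL2K ℂ (F.P K).d (fun _ => (F.P K).sitesPerDir 0) (c0Rec F K k) (WRec N) →ₗ[ℂ]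
      SiteL2K ℂ (F.P K).d (fun _ => (F.P K).sitesPerDir 0) (c0Rec F K k) (WRec N))
    (Q' : SiteL2K ℂ (F.P K).d (fun _ => (F.P K).sitesPerDir 0) (c0Rec F K k) (WRec N) →ₗ[ℂ] F')
    (Δ2 : BondL2K ℂ (F.P K).d (fun _ => (F.P K).sitesPerDir 0) (c0Rec F K k) (WRec N) →ₗ[ℂ]
      BondL2K ℂ (F.P K).d (fun _ => (F.P K).sitesPerDir 0) (c0Rec F K k) (WRec N)) :
    BondL2K ℂ (F.P K).d (fun _ => (F.P K).sitesPerDir 0) (c0Rec F K k) (WRec N) →ₗ[ℂ]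
      BondL2K ℂ (F.P K).d (fun _ => (F.P K).sitesPerDir 0) (c0Rec F K k) (WRec N) :=
  LinearMap.adjoint (piOfRecord F N k U₀ Gp Q') ∘ₗ (hessOpOfRecord F N k U₀ + Δ2) ∘ₗ piOfRecord F N k U₀ Gp Q'

/-- At `Δ⁽²⁾ := 0` the slot-(c) Hessian is the slot-(b) `Δ_π = π†Δπ`. [cite: Balaban1985BackgroundPropagators, (3.119) p.419, (3.128) p.421] -/
theorem hessOpOfRecord128_zero [Fact (0 < c0Rec F K k)]
    (Gp : SiteL2K ℂ (F.P K).d (fun _ => (F.P K).sitesPerDir 0) (c0Rec F K k) (WRec N) →ₗ[ℂ]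
      SiteL2K ℂ (F.P K).d (fun _ => (F.P K).sitesPerDir 0) (c0Rec F K k) (WRec N))
    (Q' : SiteL2K ℂ (F.P K).d (fun _ => (F.P K).sitesPerDir 0) (c0Rec F K k) (WRec N) →ₗ[ℂ] F') :
    hessOpOfRecord128 F N k U₀ Gp Q' 0 = hessOpOfRecordPi F N k U₀ Gp Q' := by
  rw [hessOpOfRecord128, add_zero, hessOpOfRecordPi]

/-- `π†(Δ + Δ⁽²⁾)π = π†Δπ + π†Δ⁽²⁾π` — (3.128)'s two summands. [cite: Balaban1985BackgroundPropagators, (3.128) p.421, (3.135) p.422] -/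
theorem hessOpOfRecord128_eq_add [Fact (0 < c0Rec F K k)]
    (Gp : SiteL2K ℂ (F.P K).d (fun _ => (F.P K).sitesPerDir 0) (c0Rec F K k) (WRec N) →ₗ[ℂ]
      SiteL2K ℂ (F.P K).d (fun _ => (F.P K).sitesPerDir 0) (c0Rec F K k) (WRec N))
    (Q' : SiteL2K ℂ (F.P K).d (fun _ => (F.P K).sitesPerDir 0) (c0Rec F K k) (WRec N) →ₗ[ℂ] F')
    (Δ2 : BondL2K ℂ (F.P K).d (fun _ => (F.P K).sitesPerDir 0) (c0Rec F K k) (WRec N) →ₗ[ℂ]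
      BondL2K ℂ (F.P K).d (fun _ => (F.P K).sitesPerDir 0) (c0Rec F K k) (WRec N)) :
    hessOpOfRecord128 F N k U₀ Gp Q' Δ2 =
      hessOpOfRecordPi F N k U₀ Gp Q' + LinearMap.adjoint (piOfRecord F N k U₀ Gp Q') ∘ₗ Δ2 ∘ₗ piOfRecord F N k U₀ Gp Q' := by
  rw [hessOpOfRecord128, hessOpOfRecordPi, LinearMap.add_comp, LinearMap.comp_add]

/-- **THE SLOT-(c) HESSIAN KILLS THE `N(Q′)` GAUGE MODES** (from (g5) alone; no letter on `Δ`, `Δ⁽²⁾`).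
[cite: Balaban1985BackgroundPropagators, (3.119) p.419, (3.128) p.421] -/
theorem hessOpOfRecord128_gaugeMode [Fact (0 < c0Rec F K k)]
    (Gp : SiteL2K ℂ (F.P K).d (fun _ => (F.P K).sitesPerDir 0) (c0Rec F K k) (WRec N) →ₗ[ℂ]
      SiteL2K ℂ (F.P K).d (fun _ => (F.P K).sitesPerDir 0) (c0Rec F K k) (WRec N))
    (Q' : SiteL2K ℂ (F.P K).d (fun _ => (F.P K).sitesPerDir 0) (c0Rec F K k) (WRec N) →ₗ[ℂ] F')
    (Δ2 : BondL2K ℂ (F.P K).d (fun _ => (F.P K).sitesPerDir 0) (c0Rec F K k) (WRec N) →ₗ[ℂ]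
      BondL2K ℂ (F.P K).d (fun _ => (F.P K).sitesPerDir 0) (c0Rec F K k) (WRec N))
    (g5 : ∀ l, Q' l = 0 → Gp (covLaplaceSiteK (cRec F K k) (RRec F N U₀) (SRec F N U₀) l) = l)
    {l : SiteL2K ℂ (F.P K).d (fun _ => (F.P K).sitesPerDir 0) (c0Rec F K k) (WRec N)} (hl : Q' l = 0) :
    hessOpOfRecord128 F N k U₀ Gp Q' Δ2 (covDerivL2K ℂ (c0Rec F K k) (cRec F K k) (RRec F N U₀) l) = 0 :=
  invariantExtension_apply_eq_zero _ _ (piOfRecord_gaugeMode F N k U₀ Gp Q' g5 hl)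

/-- **BRIDGE TO THE (3.124) ASSEMBLY OF RECORD (Summit ✓`N07PrintProjectionOfRecord`, 2026-08-31), by `rfl`**: `π(U₀; G′, Q′)` IS print's
literal `1 − D_{U₀} G′ R D*_{U₀}`; with `G′ := greenK T′ hpos′` this is letter-for-letter the projection quantified there, so its (3.124)
`Q G̃₁ D R = 0`, p. 425 `R D* G̃₁ D R = R` and `R D* G̃₁ Q* = 0` apply to the slot-(c) Hessian below with `Δ := Δ(U₀) + Δ⁽²⁾` — (3.124) is CITED
from there, not re-derived here. [cite: Balaban1985BackgroundPropagators, (3.119) p.419, (3.124) p.420] -/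
theorem piOfRecord_eq [Fact (0 < c0Rec F K k)]
    (Gp : SiteL2K ℂ (F.P K).d (fun _ => (F.P K).sitesPerDir 0) (c0Rec F K k) (WRec N) →ₗ[ℂ]
      SiteL2K ℂ (F.P K).d (fun _ => (F.P K).sitesPerDir 0) (c0Rec F K k) (WRec N))
    (Q' : SiteL2K ℂ (F.P K).d (fun _ => (F.P K).sitesPerDir 0) (c0Rec F K k) (WRec N) →ₗ[ℂ] F') :
    piOfRecord F N k U₀ Gp Q' =
      (LinearMap.id : BondL2K ℂ (F.P K).d (fun _ => (F.P K).sitesPerDir 0) (c0Rec F K k) (WRec N) →ₗ[ℂ] _) -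
        covDerivL2K ℂ (c0Rec F K k) (cRec F K k) (RRec F N U₀) ∘ₗ Gp ∘ₗ RrOfRecord F N k U₀ Q' ∘ₗ
          covDivL2K ℂ (c0Rec F K k) (cRec F K k) (SRec F N U₀) := rfl

/-- **The slot-(c) Hessian, unfolded to the literal shape `π†(Δ(U₀) + Δ⁽²⁾)π` over print's `π = 1 − DG′RD*`** (`rfl`) — the `Δ`-generic slot of
the Summit-side (3.124) assembly of record with `Δ := hessOpOfRecord + Δ2`. [cite: Balaban1985BackgroundPropagators, (3.128) p.421, (3.135) p.423, (3.119) p.419] -/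
theorem hessOpOfRecord128_eq [Fact (0 < c0Rec F K k)]
    (Gp : SiteL2K ℂ (F.P K).d (fun _ => (F.P K).sitesPerDir 0) (c0Rec F K k) (WRec N) →ₗ[ℂ]
      SiteL2K ℂ (F.P K).d (fun _ => (F.P K).sitesPerDir 0) (c0Rec F K k) (WRec N))
    (Q' : SiteL2K ℂ (F.P K).d (fun _ => (F.P K).sitesPerDir 0) (c0Rec F K k) (WRec N) →ₗ[ℂ] F')
    (Δ2 : BondL2K ℂ (F.P K).d (fun _ => (F.P K).sitesPerDir 0) (c0Rec F K k) (WRec N) →ₗ[ℂ]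
      BondL2K ℂ (F.P K).d (fun _ => (F.P K).sitesPerDir 0) (c0Rec F K k) (WRec N)) :
    hessOpOfRecord128 F N k U₀ Gp Q' Δ2 =
      LinearMap.adjoint
          ((LinearMap.id : BondL2K ℂ (F.P K).d (fun _ => (F.P K).sitesPerDir 0) (c0Rec F K k) (WRec N) →ₗ[ℂ] _) -
            covDerivL2K ℂ (c0Rec F K k) (cRec F K k) (RRec F N U₀) ∘ₗ Gp ∘ₗ RrOfRecord F N k U₀ Q' ∘ₗ
              covDivL2K ℂ (c0Rec F K k) (cRec F K k) (SRec F N U₀)) ∘ₗ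
        (hessOpOfRecord F N k U₀ + Δ2) ∘ₗ
          ((LinearMap.id : BondL2K ℂ (F.P K).d (fun _ => (F.P K).sitesPerDir 0) (c0Rec F K k) (WRec N) →ₗ[ℂ] _) -
            covDerivL2K ℂ (c0Rec F K k) (cRec F K k) (RRec F N U₀) ∘ₗ Gp ∘ₗ RrOfRecord F N k U₀ Q' ∘ₗ
              covDivL2K ℂ (c0Rec F K k) (cRec F K k) (SRec F N U₀)) := rfl

end Slots

/-! ## §5. THE LETTERS OF RECORD at `(Q(U₀), Q′♭)` for the slot-(c) Hessian: `𝔊(U₀)`, `H₁(U₀)`, `𝔄 = H₁B` (103), and `W` of (80) -/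

section Record

variable (F : T4Family) (N : ℕ) [NeZero N] (K : ℕ) (k : ℕ) (Ω : ℕ → Set (Site (F.P K) 0)) (U₀ : GaugeField (F.P K) 0 (SU N))

/-- ★ **`𝔊(U₀)` OF RECORD, SLOT (c)**: `frakGOfRecordAt` at the Hessian `π†(Δ(U₀) + Δ⁽²⁾)π` (`π = 1 − DG′R D*` with `R` from `Q′♭`), the bond
letter `Q(U₀) = QOfRecord` and the flat site letter `Q′♭ = QflatOfRecord`; data `G′ =: Gp`, `Δ⁽²⁾ =: Δ2`, `a`; displayed proofs `hpos`
([B9] Thm 3.12: positivity of (110)'s operator for this slot) and `hQ`.  `Δ2 := 0` gives the slot-(b) `𝒢̃` of (3.122); the slot-(a) letter is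
file 3c's `frakGOfRecordAtBgFlat`. [cite: Balaban1985Variational, (110)–(111) p.294, (116)–(117) p.295; Balaban1985BackgroundPropagators, (3.122) p.420, (3.128) p.421, Thm 3.12 p.421] -/
def frakGOfRecordAtBg128 [Fact (0 < (F.L : ℝ))] [Fact (0 < (F.P K).eta k)] [Fact (0 < c0Rec F K k)] [Fact (∀ c, 0 < wBRec F K k c)]
    (Gp : SiteL2K ℂ (F.P K).d (fun _ => (F.P K).sitesPerDir 0) (c0Rec F K k) (WRec N) →ₗ[ℂ]
      SiteL2K ℂ (F.P K).d (fun _ => (F.P K).sitesPerDir 0) (c0Rec F K k) (WRec N))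
    (Δ2 : BondL2K ℂ (F.P K).d (fun _ => (F.P K).sitesPerDir 0) (c0Rec F K k) (WRec N) →ₗ[ℂ]
      BondL2K ℂ (F.P K).d (fun _ => (F.P K).sitesPerDir 0) (c0Rec F K k) (WRec N)) (a : ℝ)
    (hpos : ∀ x, x ≠ 0 → 0 < RCLike.re ⟪x, laplaceAOfRecordAt F N k U₀ (hessOpOfRecord128 F N k U₀ Gp (QflatOfRecord F N k) Δ2)
      (QOfRecord F N k U₀) (QflatOfRecord F N k) a x⟫_ℂ)
    (hQ : Function.Surjective (QOfRecord F N k U₀)) : NegSizeLit F N K k Ω 3 →L[ℂ] Space115Lit F N K k Ω U₀ :=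
  frakGOfRecordAt F N K k Ω U₀ (hessOpOfRecord128 F N k U₀ Gp (QflatOfRecord F N k) Δ2) (QOfRecord F N k U₀) (QflatOfRecord F N k) a hpos hQ

/-- ★ **`H₁(U₀)` OF RECORD, SLOT (c)** — (102)–(103)'s `G₁Q*(QG₁Q*)⁻¹` with `G₁` the inverse of (110)'s operator for the slot-(c) Hessian.
[cite: Balaban1985Variational, (102)–(103) p.293, (110) p.294; Balaban1985BackgroundPropagators, (3.128)–(3.129) p.421] -/
def H1OfRecordAtBg128 [Fact (0 < (F.L : ℝ))] [Fact (0 < (F.P K).eta k)] [Fact (0 < c0Rec F K k)] [Fact (∀ c, 0 < wBRec F K k c)]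
    (levB : PBond (F.P K) k → ℕ)
    (Gp : SiteL2K ℂ (F.P K).d (fun _ => (F.P K).sitesPerDir 0) (c0Rec F K k) (WRec N) →ₗ[ℂ]
      SiteL2K ℂ (F.P K).d (fun _ => (F.P K).sitesPerDir 0) (c0Rec F K k) (WRec N))
    (Δ2 : BondL2K ℂ (F.P K).d (fun _ => (F.P K).sitesPerDir 0) (c0Rec F K k) (WRec N) →ₗ[ℂ]
      BondL2K ℂ (F.P K).d (fun _ => (F.P K).sitesPerDir 0) (c0Rec F K k) (WRec N)) (a : ℝ)
    (hpos : ∀ x, x ≠ 0 → 0 < RCLike.re ⟪x, laplaceAOfRecordAt F N k U₀ (hessOpOfRecord128 F N k U₀ Gp (QflatOfRecord F N k) Δ2)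
      (QOfRecord F N k U₀) (QflatOfRecord F N k) a x⟫_ℂ)
    (hQ : Function.Surjective (QOfRecord F N k U₀)) :
    NegSize (F.L : ℝ) ((F.P K).eta k) levB 0 (Matrix (Fin N) (Fin N) ℂ) →L[ℂ] Space115Lit F N K k Ω U₀ :=
  H1OfRecordAt F N K k Ω U₀ levB (hessOpOfRecord128 F N k U₀ Gp (QflatOfRecord F N k) Δ2) (QOfRecord F N k U₀) (QflatOfRecord F N k) a hpos hQ

/-- ★ **`𝔄 = H₁B` OF (103) AT THE RECORD, SLOT (c)**: `𝔄(V) = H₁(U₀)(B(V))` with `B = BOfRecord` (20) of file 3e′ — the `𝔄`-slot of the scheme.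
[cite: Balaban1985Variational, (103) p.293, (20) p.281, (116) p.295] -/
def frakAOfRecordAtBg128 [Fact (0 < (F.L : ℝ))] [Fact (0 < (F.P K).eta k)] [Fact (0 < c0Rec F K k)] [Fact (∀ c, 0 < wBRec F K k c)]
    (levB : PBond (F.P K) k → ℕ)
    (Gp : SiteL2K ℂ (F.P K).d (fun _ => (F.P K).sitesPerDir 0) (c0Rec F K k) (WRec N) →ₗ[ℂ]
      SiteL2K ℂ (F.P K).d (fun _ => (F.P K).sitesPerDir 0) (c0Rec F K k) (WRec N))
    (Δ2 : BondL2K ℂ (F.P K).d (fun _ => (F.P K).sitesPerDir 0) (c0Rec F K k) (WRec N) →ₗ[ℂ]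
      BondL2K ℂ (F.P K).d (fun _ => (F.P K).sitesPerDir 0) (c0Rec F K k) (WRec N)) (a : ℝ)
    (hpos : ∀ x, x ≠ 0 → 0 < RCLike.re ⟪x, laplaceAOfRecordAt F N k U₀ (hessOpOfRecord128 F N k U₀ Gp (QflatOfRecord F N k) Δ2)
      (QOfRecord F N k U₀) (QflatOfRecord F N k) a x⟫_ℂ)
    (hQ : Function.Surjective (QOfRecord F N k U₀)) (V : GaugeField (F.P K) k (SU N)) : Space115Lit F N K k Ω U₀ :=
  H1OfRecordAtBg128 F N K k Ω U₀ levB Gp Δ2 a hpos hQ (BOfRecord F N K k U₀ levB V)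

/-- Unfolding of `frakAOfRecordAtBg128` (`rfl`). [cite: Balaban1985Variational, (103) p.293 (bookkeeping)] -/
theorem frakAOfRecordAtBg128_eq [Fact (0 < (F.L : ℝ))] [Fact (0 < (F.P K).eta k)] [Fact (0 < c0Rec F K k)] [Fact (∀ c, 0 < wBRec F K k c)]
    (levB : PBond (F.P K) k → ℕ)
    (Gp : SiteL2K ℂ (F.P K).d (fun _ => (F.P K).sitesPerDir 0) (c0Rec F K k) (WRec N) →ₗ[ℂ]
      SiteL2K ℂ (F.P K).d (fun _ => (F.P K).sitesPerDir 0) (c0Rec F K k) (WRec N))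
    (Δ2 : BondL2K ℂ (F.P K).d (fun _ => (F.P K).sitesPerDir 0) (c0Rec F K k) (WRec N) →ₗ[ℂ]
      BondL2K ℂ (F.P K).d (fun _ => (F.P K).sitesPerDir 0) (c0Rec F K k) (WRec N)) (a : ℝ)
    (hpos : ∀ x, x ≠ 0 → 0 < RCLike.re ⟪x, laplaceAOfRecordAt F N k U₀ (hessOpOfRecord128 F N k U₀ Gp (QflatOfRecord F N k) Δ2)
      (QOfRecord F N k U₀) (QflatOfRecord F N k) a x⟫_ℂ)
    (hQ : Function.Surjective (QOfRecord F N k U₀)) (V : GaugeField (F.P K) k (SU N)) :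
    frakAOfRecordAtBg128 F N K k Ω U₀ levB Gp Δ2 a hpos hQ V = H1OfRecordAtBg128 F N K k Ω U₀ levB Gp Δ2 a hpos hQ (BOfRecord F N K k U₀ levB V) := rfl

/-- `𝔄(Ū^k U₀) = 0`: the record's own `k`-fold average has `B = 0` (file 3e′ `BOfRecord_self`), so `𝔄 = H₁ 0 = 0`. [cite: Balaban1985Variational, (103) p.293, (20) p.281] -/
theorem frakAOfRecordAtBg128_self [Fact (0 < (F.L : ℝ))] [Fact (0 < (F.P K).eta k)] [Fact (0 < c0Rec F K k)] [Fact (∀ c, 0 < wBRec F K k c)]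
    (levB : PBond (F.P K) k → ℕ)
    (Gp : SiteL2K ℂ (F.P K).d (fun _ => (F.P K).sitesPerDir 0) (c0Rec F K k) (WRec N) →ₗ[ℂ]
      SiteL2K ℂ (F.P K).d (fun _ => (F.P K).sitesPerDir 0) (c0Rec F K k) (WRec N))
    (Δ2 : BondL2K ℂ (F.P K).d (fun _ => (F.P K).sitesPerDir 0) (c0Rec F K k) (WRec N) →ₗ[ℂ]
      BondL2K ℂ (F.P K).d (fun _ => (F.P K).sitesPerDir 0) (c0Rec F K k) (WRec N)) (a : ℝ)
    (hpos : ∀ x, x ≠ 0 → 0 < RCLike.re ⟪x, laplaceAOfRecordAt F N k U₀ (hessOpOfRecord128 F N k U₀ Gp (QflatOfRecord F N k) Δ2)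
      (QOfRecord F N k U₀) (QflatOfRecord F N k) a x⟫_ℂ)
    (hQ : Function.Surjective (QOfRecord F N k U₀)) :
    frakAOfRecordAtBg128 F N K k Ω U₀ levB Gp Δ2 a hpos hQ (Averaging.iter (avOfRecord F N K) k U₀) = 0 := by
  rw [frakAOfRecordAtBg128_eq, BOfRecord_self, map_zero]

omit [NeZero N] in
/-- **(45) `Q(U₀)(H₁(U₀; Δ₁)B) = B` FOR EVERY HESSIAN SLOT**, hypothesis-free given the data (lit `Q_H1LatticeCLM` by name), read on the functions.
[cite: Balaban1985Variational, (45) p.285, (103) p.293] -/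
theorem Q_H1OfRecordAtBg128 [Fact (0 < (F.L : ℝ))] [Fact (0 < (F.P K).eta k)] [Fact (0 < c0Rec F K k)] [Fact (∀ c, 0 < wBRec F K k c)]
    (levB : PBond (F.P K) k → ℕ)
    (Gp : SiteL2K ℂ (F.P K).d (fun _ => (F.P K).sitesPerDir 0) (c0Rec F K k) (WRec N) →ₗ[ℂ]
      SiteL2K ℂ (F.P K).d (fun _ => (F.P K).sitesPerDir 0) (c0Rec F K k) (WRec N))
    (Δ2 : BondL2K ℂ (F.P K).d (fun _ => (F.P K).sitesPerDir 0) (c0Rec F K k) (WRec N) →ₗ[ℂ]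
      BondL2K ℂ (F.P K).d (fun _ => (F.P K).sitesPerDir 0) (c0Rec F K k) (WRec N)) (a : ℝ)
    (hpos : ∀ x, x ≠ 0 → 0 < RCLike.re ⟪x, laplaceAOfRecordAt F N k U₀ (hessOpOfRecord128 F N k U₀ Gp (QflatOfRecord F N k) Δ2)
      (QOfRecord F N k U₀) (QflatOfRecord F N k) a x⟫_ℂ)
    (hQ : Function.Surjective (QOfRecord F N k U₀)) (B : NegSize (F.L : ℝ) ((F.P K).eta k) levB 0 (Matrix (Fin N) (Fin N) ℂ)) :
    readFun (phiRec N) _ (wBRec F K k) (QOfRecord F N k U₀)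
        (JetSup.equiv _ _ (nabla115 ((F.P K).eta k) (unitsOfRecord F N U₀)) (H1OfRecordAtBg128 F N K k Ω U₀ levB Gp Δ2 a hpos hQ B)) =
      NegSup.equiv _ _ B :=
  B11Eq103H1Complex.Q_H1LatticeCLM (phiRec N) hpos hQ _ _ B

/-- ★ **`C` ON THE SLICE: `C^{𝔰𝔩}(A′) := C(P A′)`** — file 3e′'s `COfRecord` composed with the traceless projection `P = slProjLit` (§0): agrees with
`COfRecord` on print's `𝔤ᶜ`-valued fields (`slProjLit_of_trace_eq_zero`), and is the `C`-slot the tokens of (44)∕Prop. 4∕`Regime` are stated over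
(they are vacuous for `COfRecord` on the scalar directions).  [cite: Balaban1985Variational, (44) p.285, (51) p.286, (49)–(50) p.285] -/
def CslOfRecord [Fact (0 < (F.L : ℝ))] [Fact (0 < (F.P K).eta k)] (levB : PBond (F.P K) k → ℕ) :
    Space115Lit F N K k Ω U₀ → NegSize (F.L : ℝ) ((F.P K).eta k) levB 0 (Matrix (Fin N) (Fin N) ℂ) :=
  fun A => COfRecord F N K k Ω U₀ levB (slProjLit F N K k Ω U₀ A)

/-- Unfolding (`rfl`). [cite: Balaban1985Variational, (44) p.285 (bookkeeping)] -/
theorem CslOfRecord_apply [Fact (0 < (F.L : ℝ))] [Fact (0 < (F.P K).eta k)] (levB : PBond (F.P K) k → ℕ) (A : Space115Lit F N K k Ω U₀) :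
    CslOfRecord F N K k Ω U₀ levB A = COfRecord F N K k Ω U₀ levB (slProjLit F N K k Ω U₀ A) := rfl

/-- On traceless fields `C^{𝔰𝔩} = C`. [cite: Balaban1985Variational, (51) p.286, (44) p.285] -/
theorem CslOfRecord_of_trace_eq_zero [Fact (0 < (F.L : ℝ))] [Fact (0 < (F.P K).eta k)] (levB : PBond (F.P K) k → ℕ) {A : Space115Lit F N K k Ω U₀}
    (hA : ∀ b, (JetSup.equiv _ _ _ A b).trace = 0) : CslOfRecord F N K k Ω U₀ levB A = COfRecord F N K k Ω U₀ levB A := by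
  rw [CslOfRecord_apply, slProjLit_of_trace_eq_zero F N K k Ω U₀ hA]

/-- `C^{𝔰𝔩}(0) = 0` under the record's guard. [cite: Balaban1985Variational, (44) p.285] -/
theorem CslOfRecord_zero [Fact (0 < (F.L : ℝ))] [Fact (0 < (F.P K).eta k)] (levB : PBond (F.P K) k → ℕ) (hU₀ : SmallBelow (avOfRecord F N K) k U₀) :
    CslOfRecord F N K k Ω U₀ levB 0 = 0 := by
  rw [CslOfRecord_apply, map_zero, COfRecord_zero F N k Ω U₀ levB hU₀]

/-- ★ `C^{𝔰𝔩}` is ℂ-analytic at `A′ = 0` under the guard (3e′'s `analyticAt_COfRecord_zero` composed with the CLM `P`). [cite: Balaban1985Variational, p.290 («It is analytic in A′ …»), (44) p.285] -/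
theorem analyticAt_CslOfRecord_zero [Fact (0 < (F.L : ℝ))] [Fact (0 < (F.P K).eta k)] (levB : PBond (F.P K) k → ℕ)
    (hU₀ : SmallBelow (avOfRecord F N K) k U₀) : AnalyticAt ℂ (CslOfRecord F N K k Ω U₀ levB) 0 :=
  (analyticAt_COfRecord_zero F N k Ω U₀ levB hU₀).comp_of_eq ((slProjLit F N K k Ω U₀).analyticAt 0) (map_zero _)

/-- ★★ **`W` OF (80)∕(84)–(96) AT THE RECORD** — lit's `B11Eq80Current.W80` («`W = W₁ + W₂ + W₃ + curV0full` = (85) + (88) + (89) + the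
`V₀`-group (90)–(96) composed with (47)») with EVERY slot a letter of record: `ρ := rhoRec`, `τ := tauRecCLM` (`τ(ρ(ℓ)X) = ℓ X` is
`tauRecCLM_rhoRec_mul`), the bond variables `unitsOfRecord F N U₀`, Sect. C's `H := H1OfRecordAtBgFlat` (a right inverse of `Q(U₀)` as (45)
asks; slot (a) is legitimate HERE), `C := CslOfRecord` (44) — 3e′'s `COfRecord` on the traceless slice, the radius datum `ε_C`, `J := JOfRecordAtBg` (28) of file 3d′, and
`Δπ := DeltaPiCurOfRecord Gp Q′♭` (the W₇ letter).  A map `Space115Lit → NegSizeLit … 3` = the `W`-slot type of the scheme.  HONEST: a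
definition; (46), the Sect. C regime of `pair27_W80` and (3.127) are NOT asserted. [cite: Balaban1985Variational, (80) p.290, (84) p.290, (85)–(96) pp.291–292, (45)–(47) p.285] -/
def WOfRecordAt [Fact (0 < (F.L : ℝ))] [Fact (0 < (F.P K).eta k)] [Fact (0 < c0Rec F K k)] [Fact (∀ c, 0 < wBRec F K k c)]
    (levB : PBond (F.P K) k → ℕ) (a : ℝ)
    (hpos : ∀ x, x ≠ 0 → 0 < RCLike.re ⟪x, laplaceAOfRecord F N k U₀ (QOfRecord F N k U₀) (QflatOfRecord F N k) a x⟫_ℂ)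
    (hQ : Function.Surjective (QOfRecord F N k U₀)) (εC : ℝ)
    (Gp : SiteL2K ℂ (F.P K).d (fun _ => (F.P K).sitesPerDir 0) (c0Rec F K k) (WRec N) →ₗ[ℂ]
      SiteL2K ℂ (F.P K).d (fun _ => (F.P K).sitesPerDir 0) (c0Rec F K k) (WRec N)) :
    Space115Lit F N K k Ω U₀ → NegSizeLit F N K k Ω 3 :=
  B11Eq80Current.W80 (rhoRec N) (tauRecCLM N) (unitsOfRecord F N U₀) (H1OfRecordAtBgFlat F N K k Ω U₀ levB a hpos hQ)
    (CslOfRecord F N K k Ω U₀ levB) εC (JOfRecordAtBg F N K k Ω U₀) (DeltaPiCurOfRecord F N K k Ω U₀ Gp (QflatOfRecord F N k))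

/-- Unfolding of `WOfRecordAt` into lit's `W80` (`rfl`). [cite: Balaban1985Variational, (84) p.290 (bookkeeping)] -/
theorem WOfRecordAt_eq [Fact (0 < (F.L : ℝ))] [Fact (0 < (F.P K).eta k)] [Fact (0 < c0Rec F K k)] [Fact (∀ c, 0 < wBRec F K k c)]
    (levB : PBond (F.P K) k → ℕ) (a : ℝ)
    (hpos : ∀ x, x ≠ 0 → 0 < RCLike.re ⟪x, laplaceAOfRecord F N k U₀ (QOfRecord F N k U₀) (QflatOfRecord F N k) a x⟫_ℂ)
    (hQ : Function.Surjective (QOfRecord F N k U₀)) (εC : ℝ)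
    (Gp : SiteL2K ℂ (F.P K).d (fun _ => (F.P K).sitesPerDir 0) (c0Rec F K k) (WRec N) →ₗ[ℂ]
      SiteL2K ℂ (F.P K).d (fun _ => (F.P K).sitesPerDir 0) (c0Rec F K k) (WRec N)) (A' : Space115Lit F N K k Ω U₀) :
    WOfRecordAt F N K k Ω U₀ levB a hpos hQ εC Gp A' =
      B11Eq80Current.W1 (rhoRec N) (tauRecCLM N) (H1OfRecordAtBgFlat F N K k Ω U₀ levB a hpos hQ) (CslOfRecord F N K k Ω U₀ levB) εC
          (JOfRecordAtBg F N K k Ω U₀) A' +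
        B11Eq80Current.W2 (rhoRec N) (tauRecCLM N) (H1OfRecordAtBgFlat F N K k Ω U₀ levB a hpos hQ) (CslOfRecord F N K k Ω U₀ levB) εC
          (DeltaPiCurOfRecord F N K k Ω U₀ Gp (QflatOfRecord F N k)) A' +
        B11Eq80Current.W3 (rhoRec N) (tauRecCLM N) (H1OfRecordAtBgFlat F N K k Ω U₀ levB a hpos hQ) (CslOfRecord F N K k Ω U₀ levB) εC
          (DeltaPiCurOfRecord F N K k Ω U₀ Gp (QflatOfRecord F N k)) A' +
        B11Eq90V0GroupComposed.curV0full (rhoRec N) (tauRecCLM N) (unitsOfRecord F N U₀)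
          (H1OfRecordAtBgFlat F N K k Ω U₀ levB a hpos hQ) (CslOfRecord F N K k Ω U₀ levB) εC A' := rfl

end Record

end Literature.MathematicalPhysics.QuantumFieldTheory.Balaban1983to89.Node00

end
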